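import Literature.Algebra.Homology.DiscreteRepModPairingCofinal
import Literature.Algebra.Homology.DiscreteRepLayerColimitGroupCohomology
import Literature.Algebra.Homology.IntModBockstein
import HarnessLib

/-!
# Inflation of classes between trivial modules along the layers: `inflTriv` is additive, compatible with
# the transitions `Δ⧸W → Δ⧸V`, and a degree-one class is determined by its character on `Δ`
# (Serre, *Galois Cohomology* I §2.2 Prop. 8; Milne ADT I Lemma 1.7)

Topic `Algebra/Homology`; namespace `Literature.Algebra.Homology.DiscreteRep`.  Sequel to door-c4 g16's
`DiscreteRepModPairingLayers.lean` (`inflTriv V y₁`: inflation `Extⁿ_{Rep k (Δ⧸V)}(X, Y) → Extⁿ_{C_Δ}(X, Y)` of a class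
between trivial modules) and `DiscreteRepModPairingCofinal.lean`.  Theorems only (no definition, no named fact, no
instance, no notation, no `sorry`).

THE POINT.  Milne's (b) for a class formation `(Δ, C)` — surjectivity of
`α¹(Δ, ℤ/m) : Ext¹_{C_Δ}(ℤ/m, C) → Ext¹_{C_Δ}(ℤ, ℤ/m)^*` — is read on the layers (door-c4 g16
`adjointSurjective_triv_zmod_of_cofinal`): a functional on `Ext¹_{C_Δ}(ℤ, ℤ/m)` is evaluated on the inflated layer
characters `inflTriv V (E⁻¹ χ)`, `χ ∈ H¹(Δ⧸V, ℤ/m) = Hom(Δ⧸V, ℤ/m)`.  To transport such a functional to the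
arithmetic side one needs to know WHEN TWO INFLATED CHARACTERS COINCIDE.  Here:

* `inflTriv_add`, `inflTriv_zero`, `inflTriv_nsmul` — `inflTriv V` is additive;
* **`inflTriv_mapExactFunctor_layerRes`** — `inflTriv W (res_{Δ⧸W → Δ⧸V} y) = inflTriv V y` for `W ≤ V` (both are the
  restriction along `Δ → Δ⧸V`, `layerRes_comp_infFunctor`);
* **`inflTriv_symm_map_quotMap`** — the same in `groupCohomology` currency:
  `inflTriv W (E⁻¹ (Hⁿ(Δ⧸W → Δ⧸V, 𝟙) c)) = inflTriv V (E⁻¹ c)` (`E` = door-c4's dictionary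
  `RepExt.extTrivialAddEquivGroupCohomology`);
* **`inflTriv_H1IsoOfIsTrivial_inv_eq_of_forall`** — two degree-one classes `[χ₁] ∈ H¹(Δ⧸V₁, Y)`, `[χ₂] ∈ H¹(Δ⧸V₂, Y)`
  whose characters agree ON `Δ` have the same inflation in `Ext¹_{C_Δ}(ℤ, Y)` (pass to `V₁ ⊓ V₂`; door-c6
  `Bockstein.map_H1IsoOfIsTrivial_inv_comp`);
* `nsmul_inflTriv_H1IsoOfIsTrivial_inv_eq_zero` — `m • inflTriv V (E⁻¹ [χ]) = 0` for a `ℤ/m`-valued character `χ`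
  (so functionals on these classes take values in the `m`-torsion).

HONEST FRAMING: bookkeeping over door-c4's colimit theorem (d); no arithmetic.  Route A (A5)-ARITH of crux
`AnticycControlAdditiveK` (item 19295, cell bsd-schneider), seat door-c4 gen 17 (surjectivity half of
`TateDualityHypotheses.adjointBijective_one_zmod` for the idèle class formation).

## References
* J.-P. Serre, *Galois Cohomology* (1997), I §2.2 Proposition 8. [SerreGaloisCohomology1997]
* J. S. Milne, *Arithmetic Duality Theorems* (2nd ed. 2006), I §1 Lemma 1.7, Theorem 1.8 (b). [MilneADT2006]
* K. S. Brown, *Cohomology of Groups* (1982), III §8 (functoriality of `H¹`). [Brown1982CohomologyGroups]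
-/

noncomputable section

namespace Literature.Algebra.Homology

namespace DiscreteRep

open CategoryTheory CategoryTheory.Limits CategoryTheory.Abelian groupCohomology

variable {Δ : Type} [Group Δ] [TopologicalSpace Δ] [IsTopologicalGroup Δ]
variable {k : Type} [CommRing k]

/-! ## §1 `inflTriv V` is additive -/

section Additive

variable (V : Subgroup Δ) [V.Normal] (hV : IsOpen (V : Set Δ))
  {X Y : Type} [AddCommGroup X] [Module k X] [AddCommGroup Y] [Module k Y] {n : ℕ}

/-- **`inflTriv V` is additive** (`Ext.mapExactFunctor_add`, `Ext.add_comp`).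
[cite: SerreGaloisCohomology1997, I §2.2 Proposition 8] -/
theorem inflTriv_add (y y' : Ext (Rep.trivial k (Δ ⧸ V) X) (Rep.trivial k (Δ ⧸ V) Y) n) :
    inflTriv V hV (y + y') = inflTriv V hV y + inflTriv V hV y' := by
  rw [inflTriv_def, inflTriv_def, inflTriv_def, Ext.mapExactFunctor_add, Ext.add_comp]

/-- `inflTriv V 0 = 0`. [cite: SerreGaloisCohomology1997, I §2.2 Proposition 8] -/
theorem inflTriv_zero :
    inflTriv V hV (0 : Ext (Rep.trivial k (Δ ⧸ V) X) (Rep.trivial k (Δ ⧸ V) Y) n) = 0 := by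
  rw [inflTriv_def, Ext.mapExactFunctor_zero, Ext.zero_comp]

/-- `inflTriv V (c • y) = c • inflTriv V y` for `c : ℕ`. [cite: SerreGaloisCohomology1997, I §2.2 Proposition 8] -/
theorem inflTriv_nsmul (c : ℕ) (y : Ext (Rep.trivial k (Δ ⧸ V) X) (Rep.trivial k (Δ ⧸ V) Y) n) :
    inflTriv V hV (c • y) = c • inflTriv V hV y :=
  (AddMonoidHom.mk' (fun y : Ext (Rep.trivial k (Δ ⧸ V) X) (Rep.trivial k (Δ ⧸ V) Y) n => inflTriv V hV y)
    (inflTriv_add V hV)).map_nsmul c y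

/-- `inflTriv V (y - y') = inflTriv V y - inflTriv V y'`. [cite: SerreGaloisCohomology1997, I §2.2 Proposition 8] -/
theorem inflTriv_sub (y y' : Ext (Rep.trivial k (Δ ⧸ V) X) (Rep.trivial k (Δ ⧸ V) Y) n) :
    inflTriv V hV (y - y') = inflTriv V hV y - inflTriv V hV y' :=
  (AddMonoidHom.mk' (fun y : Ext (Rep.trivial k (Δ ⧸ V) X) (Rep.trivial k (Δ ⧸ V) Y) n => inflTriv V hV y)
    (inflTriv_add V hV)).map_sub y y'

end Additive

/-! ## §2 `inflTriv` along a deeper layer -/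

section OfLE

variable (V W : Subgroup Δ) [V.Normal] [W.Normal] (hV : IsOpen (V : Set Δ)) (hW : IsOpen (W : Set Δ))
  (hWV : W ≤ V) {X Y : Type} [AddCommGroup X] [Module k X] [AddCommGroup Y] [Module k Y] {n : ℕ}

/-- **`inflTriv W (res_{Δ⧸W → Δ⧸V} y) = inflTriv V y`** for `W ≤ V`: restricting a class between trivial
`Δ⧸V`-modules to `Δ⧸W` (door-c4 `layerRes`, the restriction along `Δ⧸W → Δ⧸V`; trivial modules restrict to trivial
modules definitionally) and inflating from `W` is inflating from `V` (`layerRes ⋙ Inf_W = Inf_V`,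
`layerRes_comp_infFunctor`). [cite: SerreGaloisCohomology1997, I §2.2 Proposition 8] -/
theorem inflTriv_mapExactFunctor_layerRes (y : Ext (Rep.trivial k (Δ ⧸ V) X) (Rep.trivial k (Δ ⧸ V) Y) n) :
    inflTriv W hW (X := X) (Y := Y)
        (show Ext (Rep.trivial k (Δ ⧸ W) X) (Rep.trivial k (Δ ⧸ W) Y) n from y.mapExactFunctor (layerRes k V W hWV)) =
      inflTriv V hV y := by
  rw [inflTriv_def, inflTriv_def]
  haveI := comp_preservesFiniteLimits (layerRes k V W hWV) (infFunctor k W hW)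
  haveI := comp_preservesFiniteColimits (layerRes k V W hWV) (infFunctor k W hW)
  change ((y.mapExactFunctor (layerRes k V W hWV)).mapExactFunctor (infFunctor k W hW)).comp
      (Ext.mk₀ (infTrivIso (k := k) W hW Y).hom) (add_zero n) =
    (y.mapExactFunctor (infFunctor k V hV)).comp (Ext.mk₀ (infTrivIso (k := k) V hV Y).hom) (add_zero n)
  rw [← ExtFunctoriality.mapExactFunctor_comp_functor]
  rfl

/-- **The same in `groupCohomology` currency**: for `c ∈ Hⁿ(Δ⧸V, Y)` (trivial `Y`),
`inflTriv W (E⁻¹ (Hⁿ(Δ⧸W → Δ⧸V, 𝟙) c)) = inflTriv V (E⁻¹ c)` — Mathlib's inflation `groupCohomology.map (quotMap V W)`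
between the layers is the restriction `layerRes` under door-c4's dictionary `E`
(`RepExt.extTrivialAddEquivGroupCohomology_symm_map`).
[cite: SerreGaloisCohomology1997, I §2.2 Proposition 8][cite: Brown1982CohomologyGroups, III §8] -/
theorem inflTriv_symm_map_quotMap (c : groupCohomology (Rep.trivial k (Δ ⧸ V) Y) n) :
    inflTriv W hW (X := k) (Y := Y)
        ((RepExt.extTrivialAddEquivGroupCohomology (Rep.trivial k (Δ ⧸ W) Y) n).symm
          (groupCohomology.map (quotMap V W hWV) (A := Rep.trivial k (Δ ⧸ V) Y)
            (𝟙 (Rep.trivial k (Δ ⧸ W) Y)) n c)) =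
      inflTriv V hV ((RepExt.extTrivialAddEquivGroupCohomology (Rep.trivial k (Δ ⧸ V) Y) n).symm c) := by
  rw [← inflTriv_mapExactFunctor_layerRes V W hV hW hWV]
  exact congrArg (inflTriv W hW (X := k) (Y := Y))
    (RepExt.extTrivialAddEquivGroupCohomology_symm_map (quotMap V W hWV) (A := Rep.trivial k (Δ ⧸ V) Y) c)

end OfLE

/-! ## §3 Degree one: a class is determined by its character on `Δ` -/

section DegreeOne

variable {Y : Type} [AddCommGroup Y]

/-- **Two inflated degree-one classes with the same character on `Δ` coincide**: for open normal
`V₁, V₂ ≤ Δ` and characters `χ₁ : Δ⧸V₁ → Y`, `χ₂ : Δ⧸V₂ → Y` with `χ₁(d V₁) = χ₂(d V₂)` for all `d ∈ Δ`,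
`inflTriv V₁ (E⁻¹ [χ₁]) = inflTriv V₂ (E⁻¹ [χ₂])` in `Ext¹_{C_Δ}(ℤ, Y)` (both are inflated from `[χ₁ ∘ π₁] = [χ₂ ∘ π₂]` on
the layer `V₁ ⊓ V₂`; `Bockstein.map_H1IsoOfIsTrivial_inv_comp`).
[cite: SerreGaloisCohomology1997, I §2.2 Proposition 8][cite: Brown1982CohomologyGroups, III §8] -/
theorem inflTriv_H1IsoOfIsTrivial_inv_eq_of_forall (V₁ V₂ : OpenNormalSubgroup Δ)
    (χ₁ : Additive (Δ ⧸ (V₁ : Subgroup Δ)) →+ Y) (χ₂ : Additive (Δ ⧸ (V₂ : Subgroup Δ)) →+ Y)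
    (h : ∀ d : Δ, χ₁ (Additive.ofMul (QuotientGroup.mk d)) = χ₂ (Additive.ofMul (QuotientGroup.mk d))) :
    inflTriv (V₁ : Subgroup Δ) (LayerColimit.coe_isOpen V₁) (X := ℤ) (Y := Y)
        ((RepExt.extTrivialAddEquivGroupCohomology (Rep.trivial ℤ (Δ ⧸ (V₁ : Subgroup Δ)) Y) 1).symm
          ((H1IsoOfIsTrivial (Rep.trivial ℤ (Δ ⧸ (V₁ : Subgroup Δ)) Y)).inv χ₁)) =
      inflTriv (V₂ : Subgroup Δ) (LayerColimit.coe_isOpen V₂) (X := ℤ) (Y := Y)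
        ((RepExt.extTrivialAddEquivGroupCohomology (Rep.trivial ℤ (Δ ⧸ (V₂ : Subgroup Δ)) Y) 1).symm
          ((H1IsoOfIsTrivial (Rep.trivial ℤ (Δ ⧸ (V₂ : Subgroup Δ)) Y)).inv χ₂)) := by
  set W : OpenNormalSubgroup Δ := V₁ ⊓ V₂ with hWdef
  have hW₁ : (W : Subgroup Δ) ≤ V₁ := LayerColimit.coe_le_coe_of_le inf_le_left
  have hW₂ : (W : Subgroup Δ) ≤ V₂ := LayerColimit.coe_le_coe_of_le inf_le_right
  rw [← inflTriv_symm_map_quotMap (V₁ : Subgroup Δ) (W : Subgroup Δ) (LayerColimit.coe_isOpen V₁)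
      (LayerColimit.coe_isOpen W) hW₁,
    ← inflTriv_symm_map_quotMap (V₂ : Subgroup Δ) (W : Subgroup Δ) (LayerColimit.coe_isOpen V₂)
      (LayerColimit.coe_isOpen W) hW₂,
    Bockstein.map_H1IsoOfIsTrivial_inv_comp, Bockstein.map_H1IsoOfIsTrivial_inv_comp]
  congr 3
  refine AddMonoidHom.ext fun q => ?_
  induction q using QuotientGroup.induction_on with
  | H d => exact h d

/-- **`m • inflTriv V (E⁻¹ [χ]) = 0`** for a `ℤ/m`-valued character `χ` of `Δ⧸V` (`m • χ = 0`).
[cite: MilneADT2006, I Lemma 1.7] -/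
theorem nsmul_inflTriv_H1IsoOfIsTrivial_inv_eq_zero {m : ℕ} (V : OpenNormalSubgroup Δ)
    (χ : Additive (Δ ⧸ (V : Subgroup Δ)) →+ ZMod m) :
    m • inflTriv (V : Subgroup Δ) (LayerColimit.coe_isOpen V) (X := ℤ) (Y := ZMod m)
        ((RepExt.extTrivialAddEquivGroupCohomology (Rep.trivial ℤ (Δ ⧸ (V : Subgroup Δ)) (ZMod m)) 1).symm
          ((H1IsoOfIsTrivial (Rep.trivial ℤ (Δ ⧸ (V : Subgroup Δ)) (ZMod m))).inv χ)) = 0 := by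
  have hχ : m • χ = 0 := AddMonoidHom.ext fun q => by
    rw [AddMonoidHom.nsmul_apply, AddMonoidHom.zero_apply, nsmul_eq_mul, ZMod.natCast_self, zero_mul]
  rw [← inflTriv_nsmul, ← map_nsmul, ← map_nsmul, hχ, map_zero, map_zero, inflTriv_zero]

/-- **An additive functional on the inflated `ℤ/m`-characters takes `m`-torsion values**:
`m • Ψ (inflTriv V (E⁻¹ [χ])) = 0`. [cite: MilneADT2006, I Lemma 1.7] -/
theorem nsmul_apply_inflTriv_H1IsoOfIsTrivial_inv_eq_zero {m : ℕ} {Q : Type} [AddCommGroup Q]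
    (Ψ : Ext (triv (k := ℤ) (Γ := Δ) ℤ) (triv (k := ℤ) (Γ := Δ) (ZMod m)) 1 →+ Q) (V : OpenNormalSubgroup Δ)
    (χ : Additive (Δ ⧸ (V : Subgroup Δ)) →+ ZMod m) :
    m • Ψ (inflTriv (V : Subgroup Δ) (LayerColimit.coe_isOpen V) (X := ℤ) (Y := ZMod m)
        ((RepExt.extTrivialAddEquivGroupCohomology (Rep.trivial ℤ (Δ ⧸ (V : Subgroup Δ)) (ZMod m)) 1).symm
          ((H1IsoOfIsTrivial (Rep.trivial ℤ (Δ ⧸ (V : Subgroup Δ)) (ZMod m))).inv χ))) = 0 :=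
  (map_nsmul Ψ m _).symm.trans
    ((congrArg Ψ (nsmul_inflTriv_H1IsoOfIsTrivial_inv_eq_zero V χ)).trans (map_zero Ψ))

end DegreeOne

end DiscreteRep

end Literature.Algebra.Homology

end
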